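import Mathlib
import Summits.NavierStokesRegularity.NavierStokesRegularity.Theorems.EulerZoomLiouvillePowerGaugeEulerLiouvilleHoopCylinderDensity
import Summits.NavierStokesRegularity.NavierStokesRegularity.Theorems.EulerZoomLiouvillePowerGaugeEulerLiouvilleHoopDisc
import Summits.NavierStokesRegularity.NavierStokesRegularity.Theorems.EulerZoomLiouvillePowerGaugeEulerLiouvilleHoopRadialModes
import Summits.NavierStokesRegularity.NavierStokesRegularity.Theorems.EulerZoomLiouvillePowerGaugeEulerLiouvilleHoopCircleAvgCalculus
import HarnessLib

/-!
# HOOP LINE, K-HOOP assembly (c)(ii), part 1 — THE SLICE CHART: the hoop data along `axisPt σ t θ` in the smooth frame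
# (route `EulerZoomLiouville`, crux E = stmt-NavierStokesRegularity-19832; class-free calculus, `--supports` only)

The geometric identification that feeds ns-ezl-w2 g5's chart-free radial lemma `HoopCore.hoop_slice_le` (`…HoopRadialModes`)
with the data of a `C¹` vector field `V` on the solid cylinder `HoopCore.solidCyl s₁ s₂ T₀` about the `x₂`-axis, in the SMOOTH
frame `R_θ e₀, R_θ e₁, e_z` (`rotZ θ (single 0 1)`, `rotZ θ (single 1 1)`, `eZ`), which is defined for EVERY real `t` and agrees
with the polar frame `eR, eTheta, eZ` of `…HoopFrame` for `t > 0` (`eR_axisPt`, `eTheta_axisPt`):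

* §1 the frame along the angle: `rotZ_single_zero_eq / _one_eq`, `hasDerivAt_rotZ_single_zero / _one` (`∂_θ R_θe₀ = R_θe₁`,
  `∂_θ R_θe₁ = −R_θe₀`), `hasDerivAt_axisPt_angle'` (`∂_θ axisPt = t • R_θe₁`, all `t`), `inner_rotZ_single_zero / _one`,
  `axialVelocity_eq_inner_eZ`, `axisPt_radius_zero` (`axisPt s 0 θ = s • e_z`);
* §2 the rotated orthonormal basis: `divergence_eq_rotFrame` (`div V = ⟪DV R_θe₀, R_θe₀⟫ + ⟪DV R_θe₁, R_θe₁⟫ + ⟪DV e_z, e_z⟫`,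
  every point, every `θ`) and the FOUR-ENTRY bound `fourEntries_le_frobeniusNormSq`
  (`⟪L R_θe₁, R_θe₀⟫² + ⟪L R_θe₁, R_θe₁⟫² + ⟪L R_θe₁, e_z⟫² + ⟪L e_z, R_θe₀⟫² ≤ |L|_F²`) — the only entries of `|DV|_F²` the hoop
  inequality spends (HOOP-NOTE §4: the whole θ̂-column and the `(z,r)` entry);
* §3 the slice components `a = ⟪V∘axisPt, R_θe₀⟫` (= `V_r`), `b = ⟪V∘axisPt, R_θe₁⟫` (= `V_θ`), `c = axialVelocity V ∘ axisPt`
  (= `V_z`): their `HasDerivAt` laws in `θ`, `t`, `σ` (every `t`), joint continuity in `(σ, t, θ)`, `2π`-periodicity, and the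
  transverse divergence relation `∂_θ b + a = −t (∂_t a + ∂_z V_z)` (`hdiv` of `hoop_slice_le`) from `div V = 0`;
The sibling file `…HoopSliceSides` puts the two sides of `HoopCore.HoopInequality` in this chart (hoop functional, θ̂-column,
`hint₁`/`hint₂`, the axis atom, the end-disc flux); `…HoopInequality` integrates `hoop_slice_le` over `σ ∈ [s₁, s₂]` with these
inputs and performs the `σ`-integration by parts of the `∂_zV_z`-term.  HONEST FRAME: tool lemmas (cylinder-coordinate calculus) for ONE functional inequality (HOOP-NOTE §4);
nothing here is specific to Euler or Navier–Stokes; 19832 OPEN; NS regularity NOT proved.  [folklore (cylinder coordinates)]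
-/

noncomputable section

open MeasureTheory Set WithLp Metric Real Function
open scoped InnerProductSpace RealInnerProductSpace

set_option linter.dupNamespace false

namespace Summit.NavierStokesRegularity.NavierStokesRegularity.Theorems.PowerGaugeEulerLiouville.HoopCore

open Literature.Analysis Literature.Analysis.FluidPDE Condenser

variable {V : EuclideanSpace ℝ (Fin 3) → EuclideanSpace ℝ (Fin 3)}

/-! ## §1 The smooth frame `R_θ e₀, R_θ e₁, e_z` along the angle -/

/-- `R_θ e₀ = cos θ • e₀ + sin θ • e₁`. [folklore] -/
theorem rotZ_single_zero_eq (θ : ℝ) : rotZ θ (EuclideanSpace.single (0 : Fin 3) (1 : ℝ)) =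
    Real.cos θ • EuclideanSpace.single (0 : Fin 3) (1 : ℝ) + Real.sin θ • EuclideanSpace.single (1 : Fin 3) (1 : ℝ) := by
  ext i
  fin_cases i <;> simp [rotZ]

/-- `R_θ e₁ = −sin θ • e₀ + cos θ • e₁`. [folklore] -/
theorem rotZ_single_one_eq (θ : ℝ) : rotZ θ (EuclideanSpace.single (1 : Fin 3) (1 : ℝ)) =
    (-Real.sin θ) • EuclideanSpace.single (0 : Fin 3) (1 : ℝ) + Real.cos θ • EuclideanSpace.single (1 : Fin 3) (1 : ℝ) := by
  ext i
  fin_cases i <;> simp [rotZ]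

/-- `θ ↦ R_θ e₀` is continuous. [folklore] -/
theorem continuous_rotZ_single_zero : Continuous fun θ : ℝ => rotZ θ (EuclideanSpace.single (0 : Fin 3) (1 : ℝ)) := by
  simp_rw [rotZ_single_zero_eq]
  fun_prop

/-- `θ ↦ R_θ e₁` is continuous. [folklore] -/
theorem continuous_rotZ_single_one : Continuous fun θ : ℝ => rotZ θ (EuclideanSpace.single (1 : Fin 3) (1 : ℝ)) := by
  simp_rw [rotZ_single_one_eq]
  fun_prop

/-- `∂_θ R_θ e₀ = R_θ e₁`. [folklore] -/
theorem hasDerivAt_rotZ_single_zero (θ : ℝ) :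
    HasDerivAt (fun θ : ℝ => rotZ θ (EuclideanSpace.single (0 : Fin 3) (1 : ℝ)))
      (rotZ θ (EuclideanSpace.single (1 : Fin 3) (1 : ℝ))) θ := by
  have h : HasDerivAt (fun θ : ℝ => Real.cos θ • EuclideanSpace.single (0 : Fin 3) (1 : ℝ) +
      Real.sin θ • EuclideanSpace.single (1 : Fin 3) (1 : ℝ))
      ((-Real.sin θ) • EuclideanSpace.single (0 : Fin 3) (1 : ℝ) +
        Real.cos θ • EuclideanSpace.single (1 : Fin 3) (1 : ℝ)) θ :=
    ((Real.hasDerivAt_cos θ).smul_const _).add ((Real.hasDerivAt_sin θ).smul_const _)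
  simp_rw [rotZ_single_zero_eq, rotZ_single_one_eq]
  exact h

/-- `∂_θ R_θ e₁ = −R_θ e₀`. [folklore] -/
theorem hasDerivAt_rotZ_single_one (θ : ℝ) :
    HasDerivAt (fun θ : ℝ => rotZ θ (EuclideanSpace.single (1 : Fin 3) (1 : ℝ)))
      (-rotZ θ (EuclideanSpace.single (0 : Fin 3) (1 : ℝ))) θ := by
  have h : HasDerivAt (fun θ : ℝ => (-Real.sin θ) • EuclideanSpace.single (0 : Fin 3) (1 : ℝ) +
      Real.cos θ • EuclideanSpace.single (1 : Fin 3) (1 : ℝ))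
      ((-Real.cos θ) • EuclideanSpace.single (0 : Fin 3) (1 : ℝ) +
        (-Real.sin θ) • EuclideanSpace.single (1 : Fin 3) (1 : ℝ)) θ :=
    ((Real.hasDerivAt_sin θ).neg.smul_const _).add ((Real.hasDerivAt_cos θ).smul_const _)
  have e : -rotZ θ (EuclideanSpace.single (0 : Fin 3) (1 : ℝ)) =
      (-Real.cos θ) • EuclideanSpace.single (0 : Fin 3) (1 : ℝ) +
        (-Real.sin θ) • EuclideanSpace.single (1 : Fin 3) (1 : ℝ) := by
    rw [rotZ_single_zero_eq, neg_add, neg_smul, neg_smul]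
  simp_rw [rotZ_single_one_eq]
  rw [e]
  exact h

/-- `∂_θ axisPt s t θ = t • R_θ e₁` (every `t`, no sign condition; companion of `…HoopFrame.hasDerivAt_axisPt`, which is the
`t > 0` form with `eTheta`). [folklore] -/
theorem hasDerivAt_axisPt_angle' (s t θ : ℝ) :
    HasDerivAt (fun θ : ℝ => axisPt s t θ) (t • rotZ θ (EuclideanSpace.single (1 : Fin 3) (1 : ℝ))) θ := by
  have h : (fun θ : ℝ => axisPt s t θ) =
      fun θ => s • eZ + t • rotZ θ (EuclideanSpace.single (0 : Fin 3) (1 : ℝ)) := by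
    funext θ; exact axisPt_eq_axis_add s t θ
  rw [h]
  exact ((hasDerivAt_rotZ_single_zero θ).const_smul t).const_add (s • eZ)

/-- `R_{2π} = R_0` on `e₀`. [folklore] -/
theorem rotZ_two_pi_single_zero :
    rotZ (2 * π) (EuclideanSpace.single (0 : Fin 3) (1 : ℝ)) = rotZ 0 (EuclideanSpace.single (0 : Fin 3) (1 : ℝ)) := by
  rw [rotZ_single_zero_eq, rotZ_single_zero_eq, Real.cos_two_pi, Real.sin_two_pi, Real.cos_zero, Real.sin_zero]

/-- `R_{2π} = R_0` on `e₁`. [folklore] -/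
theorem rotZ_two_pi_single_one :
    rotZ (2 * π) (EuclideanSpace.single (1 : Fin 3) (1 : ℝ)) = rotZ 0 (EuclideanSpace.single (1 : Fin 3) (1 : ℝ)) := by
  rw [rotZ_single_one_eq, rotZ_single_one_eq, Real.cos_two_pi, Real.sin_two_pi, Real.cos_zero, Real.sin_zero]

/-- `axisPt s t (2π) = axisPt s t 0`. [folklore] -/
theorem axisPt_two_pi (s t : ℝ) : axisPt s t (2 * π) = axisPt s t 0 := by
  have h := periodic_axisPt s t 0
  rwa [zero_add] at h

/-- `⟪v, R_θ e₀⟫ = v₀ cos θ + v₁ sin θ`. [folklore] -/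
theorem inner_rotZ_single_zero (v : EuclideanSpace ℝ (Fin 3)) (θ : ℝ) :
    ⟪v, rotZ θ (EuclideanSpace.single (0 : Fin 3) (1 : ℝ))⟫ = v 0 * Real.cos θ + v 1 * Real.sin θ := by
  rw [real_inner_eq_sum_three]
  simp [rotZ]

/-- `⟪v, R_θ e₁⟫ = −v₀ sin θ + v₁ cos θ`. [folklore] -/
theorem inner_rotZ_single_one (v : EuclideanSpace ℝ (Fin 3)) (θ : ℝ) :
    ⟪v, rotZ θ (EuclideanSpace.single (1 : Fin 3) (1 : ℝ))⟫ = -(v 0 * Real.sin θ) + v 1 * Real.cos θ := by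
  rw [real_inner_eq_sum_three]
  simp [rotZ]

/-- `axialVelocity V y = ⟪V y, e_z⟫`. [folklore] -/
theorem axialVelocity_eq_inner_eZ (V : EuclideanSpace ℝ (Fin 3) → EuclideanSpace ℝ (Fin 3)) (y : EuclideanSpace ℝ (Fin 3)) :
    axialVelocity V y = ⟪V y, eZ⟫ := by
  simp [axialVelocity, eZ, EuclideanSpace.inner_single_right]

/-- On the axis the chart point is the axis point: `axisPt s 0 θ = s • e_z`. [folklore] -/
theorem axisPt_radius_zero (s θ : ℝ) : axisPt s 0 θ = s • eZ := by
  rw [axisPt_eq_axis_add, zero_smul, add_zero]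

/-- For `t > 0` the smooth frame is the polar frame: `⟪V(y), R_θe₀⟫ = V_r(y)`, `y = axisPt s t θ`. [folklore] -/
theorem inner_rotZ_single_zero_eq_radialVelocity (V : EuclideanSpace ℝ (Fin 3) → EuclideanSpace ℝ (Fin 3)) (s : ℝ)
    {t : ℝ} (ht : 0 < t) (θ : ℝ) :
    ⟪V (axisPt s t θ), rotZ θ (EuclideanSpace.single (0 : Fin 3) (1 : ℝ))⟫ = radialVelocity V (axisPt s t θ) := by
  rw [radialVelocity, eR_axisPt s ht θ]

/-- For `t > 0`: `⟪V(y), R_θe₁⟫ = V_θ(y)`, `y = axisPt s t θ`. [folklore] -/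
theorem inner_rotZ_single_one_eq_swirlVelocity (V : EuclideanSpace ℝ (Fin 3) → EuclideanSpace ℝ (Fin 3)) (s : ℝ)
    {t : ℝ} (ht : 0 < t) (θ : ℝ) :
    ⟪V (axisPt s t θ), rotZ θ (EuclideanSpace.single (1 : Fin 3) (1 : ℝ))⟫ = swirlVelocity V (axisPt s t θ) := by
  rw [swirlVelocity, eTheta_axisPt s ht θ]

/-! ## §2 The rotated orthonormal basis: divergence and the four spent entries of `|DV|_F²` -/

/-- **Divergence in the rotated frame** (trace in the orthonormal basis `R_θe₀, R_θe₁, e_z`; every point, every `θ`):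
`div V (y) = ⟪DV(y) R_θe₀, R_θe₀⟫ + ⟪DV(y) R_θe₁, R_θe₁⟫ + ⟪DV(y) e_z, e_z⟫`. [folklore] -/
theorem divergence_eq_rotFrame (V : EuclideanSpace ℝ (Fin 3) → EuclideanSpace ℝ (Fin 3)) (y : EuclideanSpace ℝ (Fin 3))
    (θ : ℝ) :
    VectorCalculus.divergence V y =
      ⟪fderiv ℝ V y (rotZ θ (EuclideanSpace.single (0 : Fin 3) (1 : ℝ))), rotZ θ (EuclideanSpace.single (0 : Fin 3) (1 : ℝ))⟫ +
        ⟪fderiv ℝ V y (rotZ θ (EuclideanSpace.single (1 : Fin 3) (1 : ℝ))), rotZ θ (EuclideanSpace.single (1 : Fin 3) (1 : ℝ))⟫ +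
        ⟪fderiv ℝ V y eZ, eZ⟫ := by
  rw [divergence_eq_sum_inner_fderiv ((EuclideanSpace.basisFun (Fin 3) ℝ).map (rotZLIE θ)) V y, Fin.sum_univ_three]
  simp only [OrthonormalBasis.map_apply, EuclideanSpace.basisFun_apply, rotZLIE_apply]
  rw [← eZ_eq_rotZ θ, real_inner_comm (rotZ θ _), real_inner_comm (rotZ θ _), real_inner_comm eZ]

/-- **The four spent entries of the Frobenius norm** (HOOP-NOTE §4: the θ̂-column and the `(z, r)` entry): for every linear `L`
and every `θ`, `⟪L R_θe₁, R_θe₀⟫² + ⟪L R_θe₁, R_θe₁⟫² + ⟪L R_θe₁, e_z⟫² + ⟪L e_z, R_θe₀⟫² ≤ |L|_F²`. [folklore] -/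
theorem fourEntries_le_frobeniusNormSq (L : EuclideanSpace ℝ (Fin 3) →L[ℝ] EuclideanSpace ℝ (Fin 3)) (θ : ℝ) :
    ⟪L (rotZ θ (EuclideanSpace.single (1 : Fin 3) (1 : ℝ))), rotZ θ (EuclideanSpace.single (0 : Fin 3) (1 : ℝ))⟫ ^ 2 +
        ⟪L (rotZ θ (EuclideanSpace.single (1 : Fin 3) (1 : ℝ))), rotZ θ (EuclideanSpace.single (1 : Fin 3) (1 : ℝ))⟫ ^ 2 +
        ⟪L (rotZ θ (EuclideanSpace.single (1 : Fin 3) (1 : ℝ))), eZ⟫ ^ 2 +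
        ⟪L eZ, rotZ θ (EuclideanSpace.single (0 : Fin 3) (1 : ℝ))⟫ ^ 2 ≤ frobeniusNormSq L := by
  set f₀ := rotZ θ (EuclideanSpace.single (0 : Fin 3) (1 : ℝ)) with hf₀
  set f₁ := rotZ θ (EuclideanSpace.single (1 : Fin 3) (1 : ℝ)) with hf₁
  have hF : frobeniusNormSq L = ‖L f₀‖ ^ 2 + ‖L f₁‖ ^ 2 + ‖L eZ‖ ^ 2 := by
    rw [frobeniusNormSq_eq_sum ((EuclideanSpace.basisFun (Fin 3) ℝ).map (rotZLIE θ)) L, Fin.sum_univ_three]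
    simp only [OrthonormalBasis.map_apply, EuclideanSpace.basisFun_apply, rotZLIE_apply]
    rw [← eZ_eq_rotZ θ]
  have h1 : ‖L f₁‖ ^ 2 = ⟪L f₁, f₀⟫ ^ 2 + ⟪L f₁, f₁⟫ ^ 2 + ⟪L f₁, eZ⟫ ^ 2 := by
    rw [← ((EuclideanSpace.basisFun (Fin 3) ℝ).map (rotZLIE θ)).sum_sq_inner_right (L f₁), Fin.sum_univ_three]
    simp only [OrthonormalBasis.map_apply, EuclideanSpace.basisFun_apply, rotZLIE_apply]
    rw [← eZ_eq_rotZ θ, real_inner_comm (L f₁), real_inner_comm (L f₁), real_inner_comm (L f₁)]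
  have h2 : ⟪L eZ, f₀⟫ ^ 2 ≤ ‖L eZ‖ ^ 2 := by
    have h := abs_real_inner_le_norm (L eZ) f₀
    rw [hf₀, norm_rotZ_single_zero, mul_one] at h
    rw [← sq_abs]
    exact pow_le_pow_left₀ (abs_nonneg _) h 2
  rw [hF, h1]
  nlinarith [sq_nonneg ‖L f₀‖]

/-! ## §3 The slice components along `axisPt σ t θ` and their derivative laws (every `t`) -/

/-- **Angular law of `a = ⟪V∘axisPt, R_θe₀⟫`**: `∂_θ a = t ⟪DV R_θe₁, R_θe₀⟫ + ⟪V, R_θe₁⟫` (every `t`). [folklore] -/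
theorem hasDerivAt_sliceA_angle (hV : Differentiable ℝ V) (s t θ : ℝ) :
    HasDerivAt (fun θ : ℝ => ⟪V (axisPt s t θ), rotZ θ (EuclideanSpace.single (0 : Fin 3) (1 : ℝ))⟫)
      (t * ⟪fderiv ℝ V (axisPt s t θ) (rotZ θ (EuclideanSpace.single (1 : Fin 3) (1 : ℝ))),
          rotZ θ (EuclideanSpace.single (0 : Fin 3) (1 : ℝ))⟫ +
        ⟪V (axisPt s t θ), rotZ θ (EuclideanSpace.single (1 : Fin 3) (1 : ℝ))⟫) θ := by
  have h1 : HasDerivAt (fun θ : ℝ => V (axisPt s t θ))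
      (fderiv ℝ V (axisPt s t θ) (t • rotZ θ (EuclideanSpace.single (1 : Fin 3) (1 : ℝ)))) θ :=
    (hV _).hasFDerivAt.comp_hasDerivAt θ (hasDerivAt_axisPt_angle' s t θ)
  have h := h1.inner ℝ (hasDerivAt_rotZ_single_zero θ)
  refine h.congr_deriv ?_
  rw [map_smul, real_inner_smul_left]
  ring

/-- **Angular law of `b = ⟪V∘axisPt, R_θe₁⟫`**: `∂_θ b = t ⟪DV R_θe₁, R_θe₁⟫ − ⟪V, R_θe₀⟫` (every `t`). [folklore] -/
theorem hasDerivAt_sliceB_angle (hV : Differentiable ℝ V) (s t θ : ℝ) :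
    HasDerivAt (fun θ : ℝ => ⟪V (axisPt s t θ), rotZ θ (EuclideanSpace.single (1 : Fin 3) (1 : ℝ))⟫)
      (t * ⟪fderiv ℝ V (axisPt s t θ) (rotZ θ (EuclideanSpace.single (1 : Fin 3) (1 : ℝ))),
          rotZ θ (EuclideanSpace.single (1 : Fin 3) (1 : ℝ))⟫ -
        ⟪V (axisPt s t θ), rotZ θ (EuclideanSpace.single (0 : Fin 3) (1 : ℝ))⟫) θ := by
  have h1 : HasDerivAt (fun θ : ℝ => V (axisPt s t θ))
      (fderiv ℝ V (axisPt s t θ) (t • rotZ θ (EuclideanSpace.single (1 : Fin 3) (1 : ℝ)))) θ :=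
    (hV _).hasFDerivAt.comp_hasDerivAt θ (hasDerivAt_axisPt_angle' s t θ)
  have h := h1.inner ℝ (hasDerivAt_rotZ_single_one θ)
  refine h.congr_deriv ?_
  rw [map_smul, real_inner_smul_left, inner_neg_right]
  ring

/-- **Angular law of `c = V_z∘axisPt`**: `∂_θ c = t ⟪DV R_θe₁, e_z⟫` (every `t`; the `t > 0` form with `eTheta` is
`…HoopFrame.hasDerivAt_axialVelocity_axisPt`). [folklore] -/
theorem hasDerivAt_sliceC_angle (hV : Differentiable ℝ V) (s t θ : ℝ) :
    HasDerivAt (fun θ : ℝ => axialVelocity V (axisPt s t θ))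
      (t * ⟪fderiv ℝ V (axisPt s t θ) (rotZ θ (EuclideanSpace.single (1 : Fin 3) (1 : ℝ))), eZ⟫) θ := by
  have h1 : HasDerivAt (fun θ : ℝ => V (axisPt s t θ))
      (fderiv ℝ V (axisPt s t θ) (t • rotZ θ (EuclideanSpace.single (1 : Fin 3) (1 : ℝ)))) θ :=
    (hV _).hasFDerivAt.comp_hasDerivAt θ (hasDerivAt_axisPt_angle' s t θ)
  have h := h1.inner ℝ (hasDerivAt_const θ eZ)
  simp only [inner_zero_right, zero_add, map_smul, real_inner_smul_left] at h
  simp_rw [axialVelocity_eq_inner_eZ]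
  exact h

/-- **Radial law of `a`**: `∂_t a = ⟪DV R_θe₀, R_θe₀⟫` (every `t`). [folklore] -/
theorem hasDerivAt_sliceA_radius (hV : Differentiable ℝ V) (s t θ : ℝ) :
    HasDerivAt (fun t : ℝ => ⟪V (axisPt s t θ), rotZ θ (EuclideanSpace.single (0 : Fin 3) (1 : ℝ))⟫)
      ⟪fderiv ℝ V (axisPt s t θ) (rotZ θ (EuclideanSpace.single (0 : Fin 3) (1 : ℝ))),
        rotZ θ (EuclideanSpace.single (0 : Fin 3) (1 : ℝ))⟫ t := by
  have h1 : HasDerivAt (fun t : ℝ => V (axisPt s t θ))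
      (fderiv ℝ V (axisPt s t θ) (rotZ θ (EuclideanSpace.single (0 : Fin 3) (1 : ℝ)))) t :=
    (hV _).hasFDerivAt.comp_hasDerivAt t (hasDerivAt_axisPt_radius' s t θ)
  have h := h1.inner ℝ (hasDerivAt_const t (rotZ θ (EuclideanSpace.single (0 : Fin 3) (1 : ℝ))))
  simpa only [inner_zero_right, zero_add] using h

/-- **Axial law of `a`**: `∂_σ a = ⟪DV e_z, R_θe₀⟫`. [folklore] -/
theorem hasDerivAt_sliceA_height (hV : Differentiable ℝ V) (s t θ : ℝ) :
    HasDerivAt (fun s : ℝ => ⟪V (axisPt s t θ), rotZ θ (EuclideanSpace.single (0 : Fin 3) (1 : ℝ))⟫)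
      ⟪fderiv ℝ V (axisPt s t θ) eZ, rotZ θ (EuclideanSpace.single (0 : Fin 3) (1 : ℝ))⟫ s := by
  have h1 : HasDerivAt (fun s : ℝ => V (axisPt s t θ)) (fderiv ℝ V (axisPt s t θ) eZ) s :=
    (hV _).hasFDerivAt.comp_hasDerivAt s (hasDerivAt_axisPt_height s t θ)
  have h := h1.inner ℝ (hasDerivAt_const s (rotZ θ (EuclideanSpace.single (0 : Fin 3) (1 : ℝ))))
  simpa only [inner_zero_right, zero_add] using h

/-- **Axial law of `c`**: `∂_σ c = ⟪DV e_z, e_z⟫ = ∂_zV_z`. [folklore] -/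
theorem hasDerivAt_sliceC_height (hV : Differentiable ℝ V) (s t θ : ℝ) :
    HasDerivAt (fun s : ℝ => axialVelocity V (axisPt s t θ)) ⟪fderiv ℝ V (axisPt s t θ) eZ, eZ⟫ s := by
  have h1 : HasDerivAt (fun s : ℝ => V (axisPt s t θ)) (fderiv ℝ V (axisPt s t θ) eZ) s :=
    (hV _).hasFDerivAt.comp_hasDerivAt s (hasDerivAt_axisPt_height s t θ)
  have h := h1.inner ℝ (hasDerivAt_const s eZ)
  simp only [inner_zero_right, zero_add] at h
  simp_rw [axialVelocity_eq_inner_eZ]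
  exact h

/-! ### Joint continuity in `(σ, t, θ)` -/

/-- `(σ, t, θ) ↦ ⟪V(axisPt σ t θ), R_θ e₀⟫` is continuous for continuous `V`. [folklore] -/
theorem continuous_sliceA (hV : Continuous V) :
    Continuous fun p : ℝ × ℝ × ℝ => ⟪V (axisPt p.1 p.2.1 p.2.2), rotZ p.2.2 (EuclideanSpace.single (0 : Fin 3) (1 : ℝ))⟫ :=
  (hV.comp continuous_axisPt).inner (continuous_rotZ_single_zero.comp (continuous_snd.comp continuous_snd))

/-- `(σ, t, θ) ↦ ⟪V(axisPt σ t θ), R_θ e₁⟫` is continuous for continuous `V`. [folklore] -/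
theorem continuous_sliceB (hV : Continuous V) :
    Continuous fun p : ℝ × ℝ × ℝ => ⟪V (axisPt p.1 p.2.1 p.2.2), rotZ p.2.2 (EuclideanSpace.single (1 : Fin 3) (1 : ℝ))⟫ :=
  (hV.comp continuous_axisPt).inner (continuous_rotZ_single_one.comp (continuous_snd.comp continuous_snd))

/-- `(σ, t, θ) ↦ V_z(axisPt σ t θ)` is continuous for continuous `V`. [folklore] -/
theorem continuous_sliceC (hV : Continuous V) :
    Continuous fun p : ℝ × ℝ × ℝ => axialVelocity V (axisPt p.1 p.2.1 p.2.2) := by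
  simp_rw [axialVelocity_eq_inner_eZ]
  exact (hV.comp continuous_axisPt).inner continuous_const

/-- The frame entries `(σ, t, θ) ↦ ⟪DV(axisPt σ t θ) u(θ), w(θ)⟫` are continuous for `V ∈ C¹` and continuous frame fields
`u, w`. [folklore] -/
theorem continuous_sliceEntry (hV : ContDiff ℝ 1 V) {u w : ℝ → EuclideanSpace ℝ (Fin 3)} (hu : Continuous u)
    (hw : Continuous w) :
    Continuous fun p : ℝ × ℝ × ℝ => ⟪fderiv ℝ V (axisPt p.1 p.2.1 p.2.2) (u p.2.2), w p.2.2⟫ :=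
  (((hV.continuous_fderiv one_ne_zero).comp continuous_axisPt).clm_apply (hu.comp (continuous_snd.comp continuous_snd))).inner
    (hw.comp (continuous_snd.comp continuous_snd))

/-- Restriction of a jointly continuous `(σ, t, θ)`-function to a slice `σ = const` is jointly continuous in `(t, θ)`
(the `uncurry` shape `hoop_slice_le` consumes). [folklore] -/
theorem continuous_uncurry_slice {F : ℝ × ℝ × ℝ → ℝ} (hF : Continuous F) (σ : ℝ) :
    Continuous (uncurry fun t θ : ℝ => F (σ, t, θ)) :=
  hF.comp (continuous_const.prodMk continuous_id)

/-- Restriction to a circle `t = const` is jointly continuous in `(σ, θ)`. [folklore] -/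
theorem continuous_uncurry_radius {F : ℝ × ℝ × ℝ → ℝ} (hF : Continuous F) (t : ℝ) :
    Continuous (uncurry fun σ θ : ℝ => F (σ, t, θ)) :=
  hF.comp (continuous_fst.prodMk (continuous_const.prodMk continuous_snd))

/-- Restriction to `θ`-integrands: `((σ, t), θ) ↦ F (σ, t, θ)` is continuous (the association used by parametric interval
integrals in two parameters). [folklore] -/
theorem continuous_uncurry_pair {F : ℝ × ℝ × ℝ → ℝ} (hF : Continuous F) :
    Continuous (uncurry fun (q : ℝ × ℝ) (θ : ℝ) => F (q.1, q.2, θ)) :=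
  hF.comp ((continuous_fst.comp continuous_fst).prodMk ((continuous_snd.comp continuous_fst).prodMk continuous_snd))

/-! ### The transverse divergence relation -/

/-- **`div V = 0` in the slice chart** (`hdiv` of `hoop_slice_le`): with `bθ = t⟪DV R_θe₁, R_θe₁⟫ − a`,
`ad = ⟪DV R_θe₀, R_θe₀⟫`, `β = ⟪DV e_z, e_z⟫`: `bθ + a = −t (ad + β)` at every `(σ, t, θ)`. [folklore] -/
theorem sliceChart_hdiv (hdiv : ∀ y, VectorCalculus.divergence V y = 0) (s t θ : ℝ) :
    (t * ⟪fderiv ℝ V (axisPt s t θ) (rotZ θ (EuclideanSpace.single (1 : Fin 3) (1 : ℝ))),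
          rotZ θ (EuclideanSpace.single (1 : Fin 3) (1 : ℝ))⟫ -
        ⟪V (axisPt s t θ), rotZ θ (EuclideanSpace.single (0 : Fin 3) (1 : ℝ))⟫) +
        ⟪V (axisPt s t θ), rotZ θ (EuclideanSpace.single (0 : Fin 3) (1 : ℝ))⟫ =
      -(t * (⟪fderiv ℝ V (axisPt s t θ) (rotZ θ (EuclideanSpace.single (0 : Fin 3) (1 : ℝ))),
          rotZ θ (EuclideanSpace.single (0 : Fin 3) (1 : ℝ))⟫ + ⟪fderiv ℝ V (axisPt s t θ) eZ, eZ⟫)) := by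
  have h := hdiv (axisPt s t θ)
  rw [divergence_eq_rotFrame V (axisPt s t θ) θ] at h
  linear_combination t * h

end Summit.NavierStokesRegularity.NavierStokesRegularity.Theorems.PowerGaugeEulerLiouville.HoopCore

end
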